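import Literature.Analysis.FluidPDE.TypeIAncientMild
import HarnessLib

/-!
# Route `LerayQuarterDissipation`, crux `FiniteDissipationLiouville` (stmt-NavierStokesRegularity-22144)
  — the scaled dissipation `E(r) = r⁻¹ ∬_{Q_r} |∇w|²` is bounded on the stratum by `2K⁺`

`--supports stmt-NavierStokesRegularity-22144` (helper; companion of `…ScaledLThree.lean`). For a
field whose slices obey Leray's quarter-rate dissipation law `∫‖∇w(s)‖² ≤ K/√(−s)` (`s < 0`), the
Caffarelli–Kohn–Nirenberg scaled dissipation on every backward cylinder at the apex is bounded
independently of the scale: `∫_{−r²}^{0} ∫_{B(0,r)} ‖∇w‖² ≤ ∫_{−r²}^{0} K⁺/√(−t) dt = 2K⁺ r`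
(`lintegral_cylinder_fderiv_sq_le`). Together with the scaled `L³` bound of `…ScaledLThree.lean`
this records that on the finite-dissipation stratum the two scale-invariant quantities
`C(r)`, `E(r)` of the ε-regularity theory are uniformly bounded (`≲ (K⁺)^{3/2}`, `≤ 2K⁺`), the
legality statement used by the route's refuter and the crux's disprover. No Navier–Stokes content
beyond the hypothesis; no summit is proved.
-/

noncomputable section

open Set MeasureTheory Filter Topology Function Metric Real
open scoped ENNReal NNReal

namespace Summit.NavierStokesRegularity.NavierStokesRegularity.Theorems.FiniteDissipationLiouville.Birth

-- the problem-side namespace duplicates `NavierStokesRegularity` by design (summit = problem)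
set_option linter.dupNamespace false

/-- `∫_{(−r², 0)} (−t)^{-1/2} dt = 2 r` for `r > 0`. -/
theorem integral_Ioo_neg_rpow_half {r : ℝ} (hr : 0 < r) :
    ∫ t in Ioo (-(r ^ 2)) 0, (-t) ^ (-(1 / 2 : ℝ)) = 2 * r := by
  have hr2 : -(r ^ 2) ≤ 0 := by nlinarith
  rw [← integral_Ioc_eq_integral_Ioo, ← intervalIntegral.integral_of_le hr2]
  have h := intervalIntegral.integral_comp_sub_left (fun x : ℝ => x ^ (-(1 / 2 : ℝ))) (0 : ℝ)
    (a := -(r ^ 2)) (b := 0)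
  simp only [zero_sub] at h
  rw [h, neg_zero, neg_neg, integral_rpow (Or.inl (by norm_num))]
  have e3 : (-(1 / 2 : ℝ)) + 1 = 1 / 2 := by norm_num
  rw [e3, Real.zero_rpow (by norm_num), sub_zero]
  have hq : (r ^ 2) ^ (1 / 2 : ℝ) = r := by
    rw [← Real.sqrt_eq_rpow, Real.sqrt_sq hr.le]
  rw [hq]
  ring

/-- **Scaled dissipation on the stratum: `∬_{Q_r(0,0)} ‖∇w‖² ≤ 2 K⁺ r`.** If the slices of `w`
obey `∫ ‖∇w(s)‖ₑ² ≤ K/√(−s)` for all `s < 0`, then for every `r > 0`,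
`∫_{t∈(−r²,0)} ∫_{B(0,r)} ‖fderiv ℝ (w t) x‖ₑ² ≤ 2 (max K 0) r` (lintegral form; the ball may be
replaced by all of `ℝ³`). -/
theorem lintegral_cylinder_fderiv_sq_le {K : ℝ}
    {w : ℝ → EuclideanSpace ℝ (Fin 3) → EuclideanSpace ℝ (Fin 3)}
    (hD : ∀ s : ℝ, s < 0 → ∫⁻ x, ‖fderiv ℝ (w s) x‖ₑ ^ 2 ≤ ENNReal.ofReal (K / Real.sqrt (-s)))
    {r : ℝ} (hr : 0 < r) :
    ∫⁻ t in Ioo (-(r ^ 2)) 0, ∫⁻ x in Metric.ball (0 : EuclideanSpace ℝ (Fin 3)) r,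
        ‖fderiv ℝ (w t) x‖ₑ ^ 2 ≤ ENNReal.ofReal (2 * max K 0 * r) := by
  set Kp : ℝ := max K 0 with hKp
  have hKp0 : 0 ≤ Kp := le_max_right _ _
  have hslice : ∀ t ∈ Ioo (-(r ^ 2)) (0 : ℝ),
      ∫⁻ x in Metric.ball (0 : EuclideanSpace ℝ (Fin 3)) r, ‖fderiv ℝ (w t) x‖ₑ ^ 2 ≤
        ENNReal.ofReal (Kp * (-t) ^ (-(1 / 2 : ℝ))) := by
    intro t ht
    have hnt : 0 < -t := neg_pos.2 ht.2
    refine (setLIntegral_le_lintegral _ _).trans ((hD t ht.2).trans (ENNReal.ofReal_le_ofReal ?_))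
    rw [Real.sqrt_eq_rpow, div_eq_mul_inv, ← Real.rpow_neg hnt.le]
    exact mul_le_mul_of_nonneg_right (le_max_left _ _) (Real.rpow_nonneg hnt.le _)
  have hint : IntegrableOn (fun t : ℝ => (-t) ^ (-(1 / 2 : ℝ))) (Ioo (-(r ^ 2)) 0) := by
    have hII : IntervalIntegrable (fun x : ℝ => x ^ (-(1 / 2 : ℝ))) volume (0 - -(r ^ 2)) (0 - 0) :=
      intervalIntegral.intervalIntegrable_rpow' (by norm_num)
    have hc := hII.comp_sub_left 0
    simp only [zero_sub, neg_neg, sub_self] at hc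
    exact (intervalIntegrable_iff_integrableOn_Ioo_of_le (by nlinarith : -(r ^ 2) ≤ (0 : ℝ))).1 hc
  calc ∫⁻ t in Ioo (-(r ^ 2)) 0, ∫⁻ x in Metric.ball (0 : EuclideanSpace ℝ (Fin 3)) r,
          ‖fderiv ℝ (w t) x‖ₑ ^ 2
      ≤ ∫⁻ t in Ioo (-(r ^ 2)) 0, ENNReal.ofReal (Kp * (-t) ^ (-(1 / 2 : ℝ))) :=
        setLIntegral_mono' measurableSet_Ioo fun t ht => hslice t ht
    _ = ENNReal.ofReal (Kp * (2 * r)) := by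
        rw [← ofReal_integral_eq_lintegral_ofReal (hint.const_mul _)]
        · rw [integral_const_mul, integral_Ioo_neg_rpow_half hr]
        · refine ae_restrict_of_forall_mem measurableSet_Ioo fun t ht => ?_
          exact mul_nonneg hKp0 (Real.rpow_nonneg (by linarith [ht.2]) _)
    _ = ENNReal.ofReal (2 * max K 0 * r) := by rw [hKp]; ring_nf

end Summit.NavierStokesRegularity.NavierStokesRegularity.Theorems.FiniteDissipationLiouville.Birth

end
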